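import Literature.Topology.FourManifolds.SeamChartCalculus
import Literature.Topology.FourManifolds.RangeHalfSliceAtlas
import Literature.Topology.FourManifolds.BoundaryLocalMinDerivative
import Literature.Topology.FourManifolds.RegularSublevelDeformation
import HarnessLib

/-!
# A curve leaving a glued piece transversally: which side it enters

Topic `Literature/Topology/FourManifolds` (namespace `Literature.Topology.FourManifolds`). For
an equidimensional `C^∞` embedding `jA : A ↪ X` of a manifold with boundary into a boundaryless
manifold (boundary datum `b_A`), a boundary point `x₁ = incl z`, an INWARD tangent vector
`V ∈ T_{x₁}A` (positive first half-space coordinate, `0 < V 0`, in Mathlib's tangent-space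
coordinates of the chart at `x₁`) and a curve `γ` in `X`, differentiable at `0`, with
`γ(0) = jA(x₁)` and `γ'(0) = d(jA)_{x₁}(V)`:

* `eventually_mem_range_and_not_mem_range` (chain rule `hasDerivAt_comp_of_mdifferentiableAt` of
  `RegularSublevelDeformation.lean`) — **for small `t > 0` the curve is in `jA(A)`, and for
  small `t < 0` it is outside `jA(A)`**.

This is the step "by replacing `v` with `-v` if necessary, we can arrange that `v > 0` in
`Int M`" of Lee 2018, Example 6.44 (boundary normal coordinates), for the normal geodesics of
`∂M` issuing into the piece `M` of a glued manifold (programme of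
`Literature.Geometry.Riemannian.BaerHankePscGluing`, layer L1). Proof: in a seam chart `K` of
`X` at `jA(x₁)` (`exists_seamChart`: `K = jA ∘ kA` on the closed half space, `K y ∈ jA(A) → 0 ≤
y 0`) the height `u(x) = (K⁻¹(jA x))₀` is a `C^∞` function on `A` near `x₁`, nonnegative, zero at
`x₁`, with nonzero differential (`du(d kA e₀) = 1`, `SeamChartCalculus`); by Fermat's theorem on
the half space (`BoundaryLocalMinDerivative`: `du(w) = (w 0) · du(e₀)` with `du(e₀) > 0`) one gets
`du(V) > 0`; hence the height `t ↦ (K⁻¹(γ t))₀` has positive derivative `du(V)` at `0`, is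
positive for small `t > 0` (so `γ t = K(…) ∈ jA(A)`) and negative for small `t < 0` (so
`γ t ∉ jA(A)`).

No definitions, no named facts (D-0026).

## References

* J. M. Lee, *Introduction to Riemannian Manifolds*, 2nd ed. (2018), Example 6.44.
  [LeeRiemannianManifolds2018]
* J. M. Lee, *Introduction to Smooth Manifolds*, 2nd ed. (2013), Prop. 5.41 and p. 118
  (inward-pointing vectors). [LeeSmoothManifolds2013]
-/

noncomputable section

open Set Function Filter
open scoped Manifold ContDiff Topology

namespace Literature.Topology.FourManifolds

open Literature.Geometry.Manifold

variable {k : ℕ} {A : Type*} [TopologicalSpace A] [ChartedSpace (EuclideanHalfSpace (k + 2)) A]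
  [IsManifold (𝓡∂ (k + 2)) ∞ A]
  {X : Type*} [TopologicalSpace X] [ChartedSpace (EuclideanSpace ℝ (Fin (k + 2))) X]
  [IsManifold (𝓡 (k + 2)) ∞ X] {jA : A → X}

/-! ### Calculus helpers -/

omit [IsManifold (𝓡∂ (k + 2)) ∞ A] [IsManifold (𝓡 (k + 2)) ∞ X]
  [ChartedSpace (EuclideanHalfSpace (k + 2)) A] [TopologicalSpace A]
  [ChartedSpace (EuclideanSpace ℝ (Fin (k + 2))) X] [TopologicalSpace X] in
/-- A real function vanishing at `0` with positive derivative there is positive just to the right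
of `0` and negative just to the left. [folklore] -/
theorem eventually_pos_and_neg_of_hasDerivAt_pos {φ : ℝ → ℝ} {c : ℝ} (hφ : HasDerivAt φ c 0)
    (hφ0 : φ 0 = 0) (hc : 0 < c) :
    (∀ᶠ t in 𝓝[>] (0 : ℝ), 0 < φ t) ∧ (∀ᶠ t in 𝓝[<] (0 : ℝ), φ t < 0) := by
  have hslope : ∀ᶠ t in 𝓝[≠] (0 : ℝ), 0 < slope φ 0 t :=
    (hasDerivAt_iff_tendsto_slope.1 hφ).eventually (lt_mem_nhds hc)
  have hslope' : ∀ᶠ t in 𝓝[≠] (0 : ℝ), 0 < φ t / t := by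
    filter_upwards [hslope] with t ht
    simpa [slope_def_field, hφ0] using ht
  constructor
  · have h : ∀ᶠ t in 𝓝[>] (0 : ℝ), 0 < φ t / t :=
      hslope'.filter_mono (nhdsWithin_mono _ fun t (ht : 0 < t) ↦ ht.ne')
    filter_upwards [h, self_mem_nhdsWithin] with t ht (ht0 : 0 < t)
    exact (div_pos_iff_of_pos_right ht0).1 ht
  · have h : ∀ᶠ t in 𝓝[<] (0 : ℝ), 0 < φ t / t :=
      hslope'.filter_mono (nhdsWithin_mono _ fun t (ht : t < 0) ↦ ht.ne)
    filter_upwards [h, self_mem_nhdsWithin] with t ht (ht0 : t < 0)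
    rcases div_pos_iff.1 ht with ⟨-, hb⟩ | ⟨ha, -⟩
    · exact absurd hb (not_lt.2 ht0.le)
    · exact ha

omit [IsManifold (𝓡∂ (k + 2)) ∞ A] [ChartedSpace (EuclideanHalfSpace (k + 2)) A]
  [TopologicalSpace A] [IsManifold (𝓡 (k + 2)) ∞ X] in
/-- Transport of a differential along equal base points and vectors (all tangent spaces are the
model vector space). [folklore] -/
theorem mfderiv_congr_point {F : X → ℝ} {p p' : X} (hp : p = p')
    {Y : TangentSpace (𝓡 (k + 2)) p} {Y' : TangentSpace (𝓡 (k + 2)) p'} (hY : Y = Y') :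
    mfderiv (𝓡 (k + 2)) 𝓘(ℝ, ℝ) F p Y = mfderiv (𝓡 (k + 2)) 𝓘(ℝ, ℝ) F p' Y' := by
  subst hp
  subst hY
  rfl

/-! ### The side on which an inward curve enters -/

/-- **A curve through a seam point with inward initial velocity enters the piece**: let
`jA : A ↪ X` be an equidimensional `C^∞` embedding of a manifold with boundary into a
boundaryless manifold, `b_A` a boundary datum, `x₁ ∈ ∂A` (`x₁ ∈ range incl`), `V ∈ T_{x₁}A` with
`0 < V 0` (inward), and `γ : ℝ → X` differentiable at `0` with `γ 0 = jA x₁` and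
`dγ_0(1) = d(jA)_{x₁} V`. Then `γ t ∈ jA(A)` for all small `t > 0` and `γ t ∉ jA(A)` for all small
`t < 0`. [cite: LeeRiemannianManifolds2018, Example 6.44] -/
theorem eventually_mem_range_and_not_mem_range
    (hjA : Manifold.IsSmoothEmbedding (𝓡∂ (k + 2)) (𝓡 (k + 2)) ∞ jA)
    (bA : BoundaryData (𝓡∂ (k + 2)) A (𝓡 (k + 1))) {x₁ : A} (hx₁ : x₁ ∈ range bA.incl)
    {V : TangentSpace (𝓡∂ (k + 2)) x₁}
    (hV : 0 < (show EuclideanSpace ℝ (Fin (k + 2)) from V) 0) {γ : ℝ → X} (hγ0 : γ 0 = jA x₁)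
    (hγd : MDifferentiableAt 𝓘(ℝ, ℝ) (𝓡 (k + 2)) γ 0)
    (hγv : mfderiv 𝓘(ℝ, ℝ) (𝓡 (k + 2)) γ 0 1 = mfderiv (𝓡∂ (k + 2)) (𝓡 (k + 2)) jA x₁ V) :
    (∀ᶠ t in 𝓝[>] (0 : ℝ), γ t ∈ range jA) ∧ (∀ᶠ t in 𝓝[<] (0 : ℝ), γ t ∉ range jA) := by
  obtain ⟨z, hz⟩ := hx₁
  -- S0: a disc of `∂A` through `z`, a half-disc resting on it, and the seam chart
  set O : Set bA.carrier :=
    bA.incl ⁻¹' (chartAt (EuclideanHalfSpace (k + 2)) (bA.incl z)).source with hO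
  have hOn : O ∈ 𝓝 z :=
    ((chartAt _ (bA.incl z)).open_source.preimage bA.continuous_incl).mem_nhds
      (mem_chart_source _ (bA.incl z))
  obtain ⟨f, hf, hfo, hfO, hzf⟩ := bA.exists_disc_subset z hOn
  obtain ⟨kA, hkA, hkAo, hface⟩ := exists_halfDisc_face_eq_of_subset_chartAt bA hf hfo (bA.incl z)
    fun x' ↦ hfO (mem_range_self x')
  obtain ⟨x₀', rfl⟩ := hzf
  set x₀ : EuclideanHalfSpace (k + 2) := EuclideanHalfSpace.face x₀' with hx₀
  have hkx₀ : kA x₀ = bA.incl (f x₀') := hface x₀'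
  obtain ⟨K, hx₀K, -, hKs, hKs', hKG, hKup⟩ := exists_seamChart hjA hkA hkAo x₀ one_pos
  -- move everything to the point `kA x₀`
  have hq : kA x₀ = x₁ := hkx₀.trans hz
  subst hq
  have hinj : Injective jA := hjA.isEmbedding.injective
  have hp₀ : K x₀.val = jA (kA x₀) := hKG x₀ hx₀K
  have hp₀T : jA (kA x₀) ∈ K.target := by rw [← hp₀]; exact K.map_source hx₀K
  -- the height function `u = (K⁻¹ ∘ jA)₀` on `A`
  set pr₀ : EuclideanSpace ℝ (Fin (k + 2)) →L[ℝ] ℝ := EuclideanSpace.proj (0 : Fin (k + 2))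
    with hpr₀
  set F : X → ℝ := fun p ↦ pr₀ (K.symm p) with hF
  set u : A → ℝ := fun x ↦ F (jA x) with hu
  have hFs : ∀ p ∈ K.target, ContMDiffAt (𝓡 (k + 2)) 𝓘(ℝ, ℝ) ∞ F p := by
    intro p hp
    have h1 : ContMDiffAt (𝓡 (k + 2)) 𝓘(ℝ, EuclideanSpace ℝ (Fin (k + 2))) ∞ K.symm p :=
      (hKs' p hp).contMDiffAt (K.open_target.mem_nhds hp)
    have h2 : ContMDiff 𝓘(ℝ, EuclideanSpace ℝ (Fin (k + 2))) 𝓘(ℝ, ℝ) ∞ (pr₀ : _ → ℝ) :=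
      pr₀.contDiff.contMDiff
    exact (h2 _).comp p h1
  have hFd : ∀ p ∈ K.target, MDifferentiableAt (𝓡 (k + 2)) 𝓘(ℝ, ℝ) F p := fun p hp ↦
    (hFs p hp).mdifferentiableAt (by simp)
  have hjd : ∀ x, MDifferentiableAt (𝓡∂ (k + 2)) (𝓡 (k + 2)) jA x := fun x ↦
    (hjA.contMDiff x).mdifferentiableAt (by simp)
  have hud : MDifferentiableAt (𝓡∂ (k + 2)) 𝓘(ℝ, ℝ) u (kA x₀) := (hFd _ hp₀T).comp _ (hjd _)
  -- chain rule for `u = F ∘ jA` at `kA x₀`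
  have hdu : ∀ W : TangentSpace (𝓡∂ (k + 2)) (kA x₀),
      mlineDeriv (𝓡∂ (k + 2)) u (kA x₀) W =
        mfderiv (𝓡 (k + 2)) 𝓘(ℝ, ℝ) F (jA (kA x₀))
          (mfderiv (𝓡∂ (k + 2)) (𝓡 (k + 2)) jA (kA x₀) W) := by
    intro W
    have h := mfderiv_comp (kA x₀) (hFd _ hp₀T) (hjd (kA x₀))
    exact DFunLike.congr_fun h W
  -- `dF = pr₀ ∘ d(K⁻¹)` on `K.target`
  have hdF : ∀ p ∈ K.target, ∀ Y : TangentSpace (𝓡 (k + 2)) p,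
      mfderiv (𝓡 (k + 2)) 𝓘(ℝ, ℝ) F p Y =
        pr₀ (mfderiv (𝓡 (k + 2)) 𝓘(ℝ, EuclideanSpace ℝ (Fin (k + 2))) K.symm p Y) := by
    intro p hp Y
    have h1 : MDifferentiableAt (𝓡 (k + 2)) 𝓘(ℝ, EuclideanSpace ℝ (Fin (k + 2))) K.symm p :=
      ((hKs' p hp).contMDiffAt (K.open_target.mem_nhds hp)).mdifferentiableAt (by simp)
    have h2 : HasMFDerivAt 𝓘(ℝ, EuclideanSpace ℝ (Fin (k + 2))) 𝓘(ℝ, ℝ) (pr₀ : _ → ℝ)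
        (K.symm p) pr₀ := pr₀.hasMFDerivAt
    have h := (h2.comp p h1.hasMFDerivAt).mfderiv
    exact DFunLike.congr_fun h Y
  -- `u ≥ 0` near `kA x₀`, `u (kA x₀) = 0`
  have hu0 : u (kA x₀) = 0 := by
    show pr₀ (K.symm (jA (kA x₀))) = 0
    rw [← hp₀, K.left_inv hx₀K]
    show x₀.val 0 = 0
    exact EuclideanHalfSpace.val_face_apply_zero x₀'
  have hmin : ∀ᶠ x in 𝓝 (kA x₀), u (kA x₀) ≤ u x := by
    have hev : ∀ᶠ x in 𝓝 (kA x₀), jA x ∈ K.target :=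
      (hjA.contMDiff (kA x₀)).continuousAt.preimage_mem_nhds (K.open_target.mem_nhds hp₀T)
    filter_upwards [hev] with x hx
    rw [hu0]
    show 0 ≤ pr₀ (K.symm (jA x))
    exact hKup _ (K.map_target hx) (by rw [K.right_inv hx]; exact mem_range_self x)
  -- `du ≠ 0`: `du (d kA e₀) = 1`
  have hdu1 : mlineDeriv (𝓡∂ (k + 2)) u (kA x₀)
      (mfderiv (𝓡∂ (k + 2)) (𝓡∂ (k + 2)) kA x₀ (inwardUnit (k + 1))) = 1 := by
    rw [hdu, mfderiv_congr_point hp₀.symm rfl, hdF _ (K.map_source hx₀K),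
      mfderiv_symm_seamChart_mfderiv_comp hKs hKs' hKG hjA.contMDiff hkA.contMDiff hx₀K]
    simp [hpr₀]
  have hdu_ne : mfderiv (𝓡∂ (k + 2)) 𝓘(ℝ, ℝ) u (kA x₀) ≠ 0 := by
    intro h
    have h1 := hdu1
    rw [mlineDeriv, h] at h1
    have h2 : (0 : ℝ) = 1 := h1
    norm_num at h2
  -- Fermat: `du V = (V 0) · du e₀ > 0`
  have hpos : 0 < mlineDeriv (𝓡∂ (k + 2)) u (kA x₀) V := by
    rw [mfderiv_apply_eq_of_isLocalMin hud hmin V]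
    exact mul_pos hV (mfderiv_inwardUnit_pos_of_isLocalMin hud hmin hdu_ne)
  -- the height along `γ`: `φ t = (K⁻¹ (γ t))₀`, `φ 0 = 0`, `φ' 0 = du V > 0`
  have hγT : ∀ᶠ t in 𝓝 (0 : ℝ), γ t ∈ K.target := by
    have hc : ContinuousAt γ 0 := hγd.continuousAt
    rw [← hγ0] at hp₀T
    exact hc.preimage_mem_nhds (K.open_target.mem_nhds hp₀T)
  have hφ : HasDerivAt (fun t ↦ F (γ t)) (mlineDeriv (𝓡∂ (k + 2)) u (kA x₀) V) 0 := by
    have hF0 : MDifferentiableAt (𝓡 (k + 2)) 𝓘(ℝ, ℝ) F (γ 0) := by rw [hγ0]; exact hFd _ hp₀T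
    have h := hasDerivAt_comp_of_mdifferentiableAt hF0 hγd
    have heq : mfderiv (𝓡 (k + 2)) 𝓘(ℝ, ℝ) F (γ 0) (mfderiv 𝓘(ℝ, ℝ) (𝓡 (k + 2)) γ 0 1) =
        mlineDeriv (𝓡∂ (k + 2)) u (kA x₀) V := by
      rw [hdu, mfderiv_congr_point hγ0 hγv]
    exact h.congr_deriv heq
  have hφ0 : F (γ 0) = 0 := by rw [hγ0]; exact hu0
  obtain ⟨hplus, hminus⟩ := eventually_pos_and_neg_of_hasDerivAt_pos hφ hφ0 hpos
  constructor
  · filter_upwards [hplus, mem_nhdsWithin_of_mem_nhds hγT] with t ht htT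
    have hy : K.symm (γ t) ∈ K.source := K.map_target htT
    have h0 : 0 ≤ (K.symm (γ t)) 0 := le_of_lt ht
    have hK : K (K.symm (γ t)) = jA (kA ⟨K.symm (γ t), h0⟩) := hKG ⟨K.symm (γ t), h0⟩ hy
    rw [K.right_inv htT] at hK
    exact ⟨_, hK.symm⟩
  · filter_upwards [hminus, mem_nhdsWithin_of_mem_nhds hγT] with t ht htT hmem
    have hy : K.symm (γ t) ∈ K.source := K.map_target htT
    have h0 : 0 ≤ (K.symm (γ t)) 0 := hKup _ hy (by rw [K.right_inv htT]; exact hmem)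
    exact absurd ht (not_lt.2 h0)

/-! ### The two sides of a tube of transversal curves -/

/-- **The two sides of a tube around the seam.** Let `jA : A ↪ X` be an equidimensional `C^∞`
embedding of a COMPACT manifold with boundary into a Hausdorff boundaryless manifold, `b_A` a
boundary datum, and `T : ∂A × ℝ → X` a map (think: the normal exponential map of the seam for
some metric) which is continuous and injective on the tube `∂A × (-ε, ε)`, restricts to the seam
inclusion on `∂A × {0}` (`T(z, 0) = jA(incl z)`), and whose curves `t ↦ T(z, t)` are
differentiable at `0` with INWARD initial velocity `d(jA)(V z)`, `0 < (V z) 0`. Then for every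
`z`: `T(z, t) ∈ jA(Int A)` for all `t ∈ (0, ε)` and `T(z, t) ∉ jA(A)` for all `t ∈ (-ε, 0)` — each
half-curve is connected, avoids the seam (injectivity), hence stays in one of the two open sides
`jA(Int A)`, `X ∖ jA(A)` of the seam, which is decided near `t = 0` by
`eventually_mem_range_and_not_mem_range`. (Lee 2018, Example 6.44: "these Fermi coordinates
restrict to smooth boundary coordinates for `M`".) [cite: LeeRiemannianManifolds2018, Example 6.44] -/
theorem tube_sides_of_inward [CompactSpace A] [T2Space X]
    (hjA : Manifold.IsSmoothEmbedding (𝓡∂ (k + 2)) (𝓡 (k + 2)) ∞ jA)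
    (bA : BoundaryData (𝓡∂ (k + 2)) A (𝓡 (k + 1))) {T : bA.carrier × ℝ → X} {ε : ℝ} (hε : 0 < ε)
    (hT0 : ∀ z, T (z, 0) = jA (bA.incl z))
    (hTinj : InjOn T ((univ : Set bA.carrier) ×ˢ Ioo (-ε) ε))
    (hTc : ContinuousOn T ((univ : Set bA.carrier) ×ˢ Ioo (-ε) ε))
    {V : Π z : bA.carrier, TangentSpace (𝓡∂ (k + 2)) (bA.incl z)}
    (hV : ∀ z, 0 < (show EuclideanSpace ℝ (Fin (k + 2)) from V z) 0)
    (hTd : ∀ z, MDifferentiableAt 𝓘(ℝ, ℝ) (𝓡 (k + 2)) (fun t : ℝ ↦ T (z, t)) 0)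
    (hTv : ∀ z, mfderiv 𝓘(ℝ, ℝ) (𝓡 (k + 2)) (fun t : ℝ ↦ T (z, t)) 0 1 =
      mfderiv (𝓡∂ (k + 2)) (𝓡 (k + 2)) jA (bA.incl z) (V z)) (z : bA.carrier) :
    (∀ t ∈ Ioo 0 ε, T (z, t) ∈ jA '' (𝓡∂ (k + 2)).interior A) ∧
      (∀ t ∈ Ioo (-ε) 0, T (z, t) ∉ range jA) := by
  have hinj : Injective jA := hjA.isEmbedding.injective
  set γ : ℝ → X := fun t ↦ T (z, t) with hγ
  obtain ⟨hplus, hminus⟩ := eventually_mem_range_and_not_mem_range hjA bA (mem_range_self z)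
    (hV z) (hT0 z) (hTd z) (hTv z)
  -- the two open sides of the seam
  set U₁ : Set X := jA '' (𝓡∂ (k + 2)).interior A with hU₁
  set U₂ : Set X := (range jA)ᶜ with hU₂
  have hU₁o : IsOpen U₁ := isOpen_image_interior_of_isSmoothEmbedding hjA
  have hU₂o : IsOpen U₂ := (isCompact_range hjA.contMDiff.continuous).isClosed.isOpen_compl
  have hdisj : Disjoint U₁ U₂ := by
    rw [Set.disjoint_iff]
    rintro p ⟨⟨a, -, rfl⟩, hp⟩
    exact hp (mem_range_self a)
  -- off `t = 0` the tube avoids the seam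
  have hside : ∀ t ∈ Ioo (-ε) ε, t ≠ 0 → γ t ∈ U₁ ∪ U₂ := by
    intro t ht ht0
    by_cases hmem : γ t ∈ range jA
    · obtain ⟨a, ha⟩ := hmem
      rcases (𝓡∂ (k + 2)).isInteriorPoint_or_isBoundaryPoint a with hai | hab
      · exact Or.inl ⟨a, hai, ha⟩
      · exfalso
        have : a ∈ range bA.incl := by rw [bA.range_incl]; exact hab
        obtain ⟨z', rfl⟩ := this
        have hEq : T (z, t) = T (z', 0) := by rw [hT0 z', ha]
        have h := hTinj (mk_mem_prod (mem_univ z) ht)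
          (mk_mem_prod (mem_univ z') ⟨by linarith, hε⟩) hEq
        exact ht0 (congrArg Prod.snd h)
    · exact Or.inr hmem
  have hγc : ∀ {a b : ℝ}, Ioo a b ⊆ Ioo (-ε) ε → ContinuousOn γ (Ioo a b) := by
    intro a b hab
    have h1 : ContinuousOn (fun t : ℝ ↦ ((z, t) : bA.carrier × ℝ)) (Ioo a b) :=
      (continuous_const.prodMk continuous_id).continuousOn
    exact hTc.comp h1 fun t ht ↦ mk_mem_prod (mem_univ z) (hab ht)
  constructor
  · -- the right half-curve lies in `jA(Int A)`
    have hsub : γ '' Ioo 0 ε ⊆ U₁ ∪ U₂ := by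
      rintro _ ⟨t, ht, rfl⟩
      exact hside t ⟨by linarith [ht.1], ht.2⟩ ht.1.ne'
    have hpre : IsPreconnected (γ '' Ioo 0 ε) :=
      isPreconnected_Ioo.image γ (hγc fun t ht ↦ ⟨by linarith [ht.1], ht.2⟩)
    rcases hpre.subset_or_subset hU₁o hU₂o hdisj hsub with h | h
    · exact fun t ht ↦ h (mem_image_of_mem γ ht)
    · exfalso
      obtain ⟨t₀, ht₀, ht₀I⟩ := (hplus.and (Ioo_mem_nhdsGT hε)).exists
      exact h (mem_image_of_mem γ ht₀I) ht₀
  · -- the left half-curve lies outside `jA(A)`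
    have hsub : γ '' Ioo (-ε) 0 ⊆ U₁ ∪ U₂ := by
      rintro _ ⟨t, ht, rfl⟩
      exact hside t ⟨ht.1, by linarith [ht.2]⟩ ht.2.ne
    have hpre : IsPreconnected (γ '' Ioo (-ε) 0) :=
      isPreconnected_Ioo.image γ (hγc fun t ht ↦ ⟨ht.1, by linarith [ht.2]⟩)
    rcases hpre.subset_or_subset hU₁o hU₂o hdisj hsub with h | h
    · exfalso
      obtain ⟨t₀, ht₀, ht₀I⟩ := (hminus.and (Ioo_mem_nhdsLT (neg_lt_zero.2 hε))).exists
      have h1 : γ t₀ ∈ U₁ := h (mem_image_of_mem γ ht₀I)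
      obtain ⟨a, -, ha⟩ := h1
      exact ht₀ ⟨a, ha⟩
    · exact fun t ht ↦ h (mem_image_of_mem γ ht)

end Literature.Topology.FourManifolds
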